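import Mathlib
import Summits.CriticalPhenomena.CardyFormulaZ2.Theses.CardyWhiteToColoured
import Literature.MathematicalPhysics.QuantumFieldTheory.GaussianFieldOfCovariance
import Literature.Analysis.FunctionSpaces.GaussianSchwartz

/-!
# `ModelExists` for route `CardyWhiteToColoured` (sub-problem `CardyFormulaZ2`)

Item `stmt-CriticalPhenomena-4599` (support): non-vacuity of the hypothesis-form objects of the
route `route-CriticalPhenomena-CardyWhiteToColoured`:

* a **white noise on `ℂ`** exists — a centred Gaussian probability measure `μ` on
  `𝒮'(ℂ) = FieldConfig ℂ` with generating functional `∫ e^{iω(f)} dμ = exp (-½ ∫ f²)`; this is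
  Glimm–Jaffe §6.2 (6.2.1)–(6.2.2) (`exists_gaussianField_of_bilinForm`, via Minlos) for the
  continuous positive symmetric form `B(f, g) = ∫ f g = ⟪f, g⟫_{L²(ℂ)}`, realised through the
  continuous embedding `𝓢(ℂ, ℝ) → L²(ℂ)` (`SchwartzMap.toLpCLM`), which makes symmetry,
  positivity and continuity of the diagonal immediate;
* the **Gaussian bumps** `y ↦ exp (-‖y - x‖² / (2ℓ²))` (`ℓ > 0`, `x ∈ ℂ`) are Schwartz functions:
  translates (`SchwartzMap.compSubConstCLM`) of the Gaussian Schwartz function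
  `realGaussianSchwartz ℂ (1 / (2ℓ²))` of `Literature.Analysis.FunctionSpaces.GaussianSchwartz`.

No definitions are introduced: the covariance form and the bump family are given as explicit
terms. References: J. Glimm, A. Jaffe, *Quantum Physics* (2nd ed. 1987), §6.2 and Thm 3.4.2.
-/

noncomputable section

namespace Summit.CriticalPhenomena.CardyFormulaZ2.Theorems

open Summit.CriticalPhenomena.CardyFormulaZ2.Theses
open MeasureTheory SchwartzMap
open scoped SchwartzMap RealInnerProductSpace ENNReal

open Literature.MathematicalPhysics.QuantumLattice Literature.MathematicalPhysics.QuantumFieldTheory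
  Literature.Analysis.FunctionSpaces

/-- The `L²(ℂ)` inner product of the `L²` classes of two real Schwartz functions on `ℂ` is
`∫ z, f z * g z`. [folklore] -/
theorem inner_toLp_two_eq_integral_mul (f g : 𝓢(ℂ, ℝ)) :
    ⟪f.toLp 2 (volume : Measure ℂ), g.toLp 2 (volume : Measure ℂ)⟫ = ∫ z, f z * g z := by
  rw [MeasureTheory.L2.inner_def]
  refine integral_congr_ae ?_
  filter_upwards [f.coeFn_toLp 2 (volume : Measure ℂ), g.coeFn_toLp 2 (volume : Measure ℂ)]
    with z hf hg
  rw [hf, hg, real_inner_eq_re_inner ℝ, RCLike.inner_apply, conj_trivial, RCLike.re_to_real,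
    mul_comm]

/-- The squared `L²(ℂ)` norm (as a self inner product) of the `L²` class of a real Schwartz
function on `ℂ` is `∫ z, f z ^ 2`. [folklore] -/
theorem inner_toLp_two_self_eq_integral_sq (f : 𝓢(ℂ, ℝ)) :
    ⟪f.toLp 2 (volume : Measure ℂ), f.toLp 2 (volume : Measure ℂ)⟫ = ∫ z, f z ^ 2 := by
  rw [inner_toLp_two_eq_integral_mul]
  exact integral_congr_ae (ae_of_all _ fun z => (sq (f z)).symm)

/-- **White noise on `ℂ` exists**: a centred Gaussian field on `𝒮'(ℂ)` with generating
functional `∫ e^{iω(f)} dμ = exp (-½ ∫ f²)` (Glimm–Jaffe §6.2 via Minlos: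
`exists_gaussianField_of_bilinForm` applied to the bilinear form
`(f, g) ↦ ⟪f, g⟫_{L²(ℂ)} = ∫ f g`, the pull-back of the `L²` inner product along the continuous
linear embedding `SchwartzMap.toLpCLM ℝ ℝ 2 volume`). [folklore] -/
theorem exists_whiteNoise :
    ∃ μ : Measure (FieldConfig ℂ), IsGaussianField μ ∧ ∀ f : 𝓢(ℂ, ℝ),
      genFunctional μ f = Complex.exp (-(1 / 2 : ℂ) * ((∫ z, f z ^ 2 : ℝ) : ℂ)) := by
  have hT : Continuous fun f : 𝓢(ℂ, ℝ) => f.toLp 2 (volume : Measure ℂ) :=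
    (SchwartzMap.toLpCLM ℝ ℝ 2 (volume : Measure ℂ)).continuous
  -- the covariance form `B(f, g) = ⟪f, g⟫_{L²}` as a bilinear form on `𝓢(ℂ, ℝ)`
  set B : LinearMap.BilinForm ℝ 𝓢(ℂ, ℝ) :=
    (innerₗ (Lp ℝ 2 (volume : Measure ℂ))).compl₁₂
      (SchwartzMap.toLpCLM ℝ ℝ 2 (volume : Measure ℂ)).toLinearMap
      (SchwartzMap.toLpCLM ℝ ℝ 2 (volume : Measure ℂ)).toLinearMap
  have hB : ∀ f g : 𝓢(ℂ, ℝ),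
      B f g = ⟪f.toLp 2 (volume : Measure ℂ), g.toLp 2 (volume : Measure ℂ)⟫ := fun f g => rfl
  have hsymm : ∀ f g : 𝓢(ℂ, ℝ), B f g = B g f := fun f g => by
    rw [hB, hB, real_inner_comm]
  have hpos : ∀ f : 𝓢(ℂ, ℝ), 0 ≤ B f f := fun f => by
    rw [hB]
    exact real_inner_self_nonneg
  have hcont : Continuous fun f : 𝓢(ℂ, ℝ) => B f f := by
    simp only [hB]
    exact hT.inner hT
  obtain ⟨μ, hμ, hgen⟩ := exists_gaussianField_of_bilinForm (E := ℂ) B hsymm hpos hcont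
  refine ⟨μ, hμ, fun f => ?_⟩
  rw [hgen f, hB, inner_toLp_two_self_eq_integral_sq f]

/-- The translate by `x` of the Gaussian Schwartz function `realGaussianSchwartz ℂ (1 / (2ℓ²))`
is the Gaussian bump `y ↦ exp (-‖y - x‖² / (2ℓ²))` (`ℓ ≠ 0`). [folklore] -/
theorem compSubConstCLM_realGaussianSchwartz_apply {ℓ : ℝ} (hℓ : ℓ ≠ 0) (x y : ℂ) :
    SchwartzMap.compSubConstCLM ℝ x (realGaussianSchwartz ℂ (1 / (2 * ℓ ^ 2))) y =
      Real.exp (-(‖y - x‖ ^ 2) / (2 * ℓ ^ 2)) := by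
  have ha : 0 < 1 / (2 * ℓ ^ 2) := by positivity
  rw [SchwartzMap.compSubConstCLM_apply, realGaussianSchwartz_apply ha]
  congr 1
  field_simp

/-- **`ModelExists`** (item `stmt-CriticalPhenomena-4599` of route `CardyWhiteToColoured`): a
white noise on `ℂ` exists (`exists_whiteNoise`) and the Gaussian bumps
`y ↦ exp (-‖y - x‖² / (2ℓ²))`, `ℓ > 0`, form a family of Schwartz functions, namely
`k ℓ x = SchwartzMap.compSubConstCLM ℝ x (realGaussianSchwartz ℂ (1 / (2ℓ²)))`. -/
theorem cardyWhiteToColoured_modelExists_proof : CardyWhiteToColoured.ModelExists := by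
  unfold CardyWhiteToColoured.ModelExists
  exact ⟨exists_whiteNoise,
    fun ℓ x => SchwartzMap.compSubConstCLM ℝ x (realGaussianSchwartz ℂ (1 / (2 * ℓ ^ 2))),
    fun ℓ hℓ x y => compSubConstCLM_realGaussianSchwartz_apply hℓ.ne' x y⟩

end Summit.CriticalPhenomena.CardyFormulaZ2.Theorems

end
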